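import Summits.Schanuel.Schanuel.Theorems.ZilberEacDirectionalExplosion
import Summits.Schanuel.Schanuel.Theorems.ZilberEacPunctureDensityPoly
import HarnessLib

/-!
# Pure targets over a graph base with an EXPLOSION ray: Zariski density via THEOREM K′

Zilber's Exponential-Algebraic Closedness, case ladder (host summit Schanuel, cell `pub-schanuel`,
seat 2, gen 11).  The extreme case of the MIXED-fibre item O51 (d) — ALL fibres pure targets,
`Fⱼ = 0`:

  `W = polyFibredGraph g A 0 = {x_{s+1} = g(x), yⱼ = Aⱼ(x)} ⊆ ℂ^{s+2} × ℂ^{s+2}`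
  (`y_{s+1}` free), exponential points = solutions of `e^{xⱼ} = Aⱼ(x)` (`j ≤ s`), with
  `y_{s+1} = e^{g(x)}`.

Existence near every lattice ray `2πi m q` (leading forms of the `Aⱼ` non-vanishing at `2πi q`) is
the unperturbed moving-polydisc theorem (`exists_exp_eq_poly_add_near_latticeCentre` with `P = 0`);
the sign of `Re g_D(2πi q)` plays no role for existence.  Along an EXPLOSION ray
(`Re g_D(2πi q) > 0`) the power coordinate `w = e^{g(x)}` is super-polynomially LARGE
(`log ‖w_m‖ ≍ m^D`), and THEOREM K′ (`ZilberEacDirectionalExplosion`) over the Zariski-dense cone of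
such rays (`coneLatticeDirections_dense`) gives:

**THEOREM (`unprojectedDense_polyFibredGraph_pure`).**  `deg g ≥ 1`, a lattice direction `q₀`
(all `q₀ⱼ ≠ 0`) with `Re g_D(2πi q₀) > 0`, all `Aⱼ ≠ 0` ⟹ `I(W ∩ Γ_exp) = I(W)` for `W = polyFibredGraph g A 0`.
(With a NEGATIVE ray this is the case `F = 0` of `unprojectedDense_polyFibredGraph_puncture`.)
Certified members for `A` dominant, `deg g ≥ 2` (`polyFibredGraph_pure_member_dense`); example
`{x₂ = -(x₀² + x₁²), y₀ = x₀, y₁ = x₁}` (`expFixedPoints_negSumSquares_member_dense`): the pairs of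
fixed points of `exp` together with `e^{-(z² + w²)}` are Zariski dense in the 3-fold.

HONEST FRAMING: explicit (degenerate: one multiplicative coordinate free) families inside an OPEN
cell; existence here is classical, NEW is the Zariski density; `EC(3,2)` OPEN; NOT Schanuel's
conjecture; EAC ⇏ SC.
-/

noncomputable section

open Complex MvPolynomial Filter Topology
open Literature.NumberTheory.Transcendental Literature.ModelTheory.Zilber
  Literature.ModelTheory.ExponentialFields

set_option linter.dupNamespace false

namespace Summit.Schanuel.Schanuel.Theorems

section Pure

variable {s : ℕ}

/-- **THEOREM (pure targets over a base with an explosion ray).**  See the module docstring. (new)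
[cite: MantovaMasser2023, §1 p.5 (the open case dim π(V) = 2 in ℂ³×ℂˣ³)] -/
theorem unprojectedDense_polyFibredGraph_pure (g : MvPolynomial (Fin (s + 1)) ℂ)
    (hD : 0 < g.totalDegree) (q₀ : Fin (s + 1) → ℤ)
    (hq₀ : 0 < (eval (fun j => 2 * Real.pi * I * (q₀ j : ℂ))
      (homogeneousComponent g.totalDegree g)).re)
    (hq₀0 : ∀ j, q₀ j ≠ 0) (A : Fin (s + 1) → MvPolynomial (Fin (s + 1)) ℂ) (hA0 : ∀ j, A j ≠ 0) :
    UnprojectedDense (polyFibredGraph g A (fun _ => 0)) := by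
  classical
  have hLhom : (-homogeneousComponent g.totalDegree g).IsHomogeneous g.totalDegree :=
    (homogeneousComponent_isHomogeneous _ _).neg
  have hq₀' : (eval (fun j => 2 * Real.pi * I * (q₀ j : ℂ))
      (-homogeneousComponent g.totalDegree g)).re < 0 := by
    rw [map_neg, Complex.neg_re]; linarith
  set LA : MvPolynomial (Fin (s + 1)) ℂ := ∏ j, homogeneousComponent (A j).totalDegree (A j) with hLA
  have hLA0 : LA ≠ 0 := Finset.prod_ne_zero_iff.2 fun j _ =>
    ExpDominant.homogeneousComponent_totalDegree_ne_zero (hA0 j)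
  refine unprojectedDense_of_directional_explosion (t := s + 1)
    (isIrreducibleClosed_polyFibredGraph g A _) (by rw [zariskiDim_polyFibredGraph])
    (fun i => Sum.inl (Fin.castSucc i)) (Sum.inr (Fin.last (s + 1)))
    (Q := {v : Fin (s + 1) → ℂ | ∃ q : Fin (s + 1) → ℤ, (v = fun i => 2 * Real.pi * I * (q i : ℂ)) ∧
      0 < (eval (fun i => 2 * Real.pi * I * (q i : ℂ)) (homogeneousComponent g.totalDegree g)).re ∧
      eval (fun i => 2 * Real.pi * I * (q i : ℂ)) LA ≠ 0})
    (fun G hG => ?_) ?_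
  · obtain ⟨q, hq, -, hGq⟩ := coneLatticeDirections_dense hLhom hq₀' hq₀0 (G * LA) (mul_ne_zero hG hLA0)
    rw [map_mul] at hGq
    refine ⟨_, ⟨q, rfl, ?_, right_ne_zero_of_mul hGq⟩, left_ne_zero_of_mul hGq⟩
    rw [map_neg, Complex.neg_re] at hq; linarith
  rintro v ⟨q, rfl, hq, hqA⟩
  have hA : ∀ j, eval (fun i => 2 * Real.pi * I * (q i : ℂ))
      (homogeneousComponent (A j).totalDegree (A j)) ≠ 0 := by
    rw [hLA, map_prod] at hqA
    exact fun j => (Finset.prod_ne_zero_iff.1 hqA) j (Finset.mem_univ j)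
  -- existence along the ray (unperturbed moving polydiscs), and a choice of solutions
  have hsol := exists_exp_eq_poly_add_near_latticeCentre q A hA (fun _ _ => 0)
    (fun _ => differentiable_const _)
    (fun j θ hθ => Eventually.of_forall fun m ξ _ => by rw [norm_zero]; exact hθ.le)
  set good : ℕ → (Fin (s + 1) → ℂ) → Prop := fun m x =>
    ‖x - fun i => (m : ℂ) * (2 * Real.pi * I * (q i : ℂ)) +
        log (eval (fun k => (m : ℂ) * (2 * Real.pi * I * (q k : ℂ))) (A i))‖ ≤ 1 / 2 ∧
      ∀ j, exp (x j) = eval x (A j) + 0 with hgood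
  set xs : ℕ → Fin (s + 1) → ℂ := fun m => Classical.epsilon (good m) with hxs
  have hxs : ∀ᶠ m : ℕ in atTop, good m (xs m) := by
    filter_upwards [hsol] with m hm
    exact Classical.epsilon_spec hm
  set p : ℕ → Fin (s + 2) ⊕ Fin (s + 2) → ℂ := fun m =>
    pgParam g A (fun _ => 0) (xs m) (exp (eval (xs m) g)) with hp
  obtain ⟨K, hK0, hK⟩ := latticeCentre_control_of_leadingForm A _
    (fun i => re_two_pi_I_mul_int (q i)) hA
  have hxv : ∀ᶠ m : ℕ in atTop,
      ‖xs m - fun i => (m : ℂ) * (2 * Real.pi * I * (q i : ℂ))‖ ≤ K * Real.log m := by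
    filter_upwards [hxs, hK] with m hm hKm
    exact (hKm (xs m) hm.1).1
  refine ⟨p, ?_, ⟨K, ?_⟩, ?_, ?_⟩
  · filter_upwards [hxs] with m hm
    refine ⟨pgParam_mem g A _ _ _, pgParam_mem_expGraph_of_solution g A _ fun j => ?_⟩
    rw [(hm.2 j), map_zero, mul_zero]
  · filter_upwards [hxv] with m hm
    have hcoord : (fun i => p m (Sum.inl (Fin.castSucc i))) = xs m := by
      funext i; simp [hp]
    rw [hcoord]
    exact hm
  · filter_upwards with m
    simp only [hp, pgParam_inr, pMulParam_last]
    exact Complex.exp_ne_zero _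
  · -- super-polynomial GROWTH of `y_{s+1} = e^{g(x)}` along the explosion ray
    set c₀ : ℝ := (eval (fun i => 2 * Real.pi * I * (q i : ℂ))
      (homogeneousComponent g.totalDegree g)).re with hc₀
    have hc₀pos : 0 < c₀ := hq
    obtain ⟨ρ, hρ, t₀, ht₀, hnear⟩ :=
      ExpDominant.eval_smul_near_top g (fun i => 2 * Real.pi * I * (q i : ℂ)) (half_pos hc₀pos)
    have hρm := eventually_le_mul_of_le_log hxv ρ hρ
    have hbound : ∀ᶠ m : ℕ in atTop, c₀ / 2 * m ≤ Real.log ‖p m (Sum.inr (Fin.last (s + 1)))‖ := by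
      filter_upwards [hρm, tendsto_natCast_atTop_atTop.eventually_ge_atTop t₀,
        eventually_ge_atTop 1] with m hm hmt hm1
      have hm0r : (0 : ℝ) < m := by exact_mod_cast (show 0 < m by omega)
      simp only [hp, pgParam_inr, pMulParam_last, Complex.norm_exp, Real.log_exp]
      set ζ : Fin (s + 1) → ℂ := fun i =>
        (xs m i - (m : ℂ) * (2 * Real.pi * I * (q i : ℂ))) / (m : ℂ) with hζ
      have hζnorm : ‖ζ‖ ≤ ρ := by
        refine (pi_norm_le_iff_of_nonneg hρ.le).2 fun i => ?_
        rw [hζ]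
        dsimp only
        rw [norm_div, Complex.norm_natCast, div_le_iff₀ hm0r]
        exact (norm_le_pi_norm (xs m - fun i => (m : ℂ) * (2 * Real.pi * I * (q i : ℂ))) i).trans hm
      have hxζ : ((m : ℝ) : ℂ) • ((fun i => 2 * Real.pi * I * (q i : ℂ)) + ζ) = xs m := by
        funext i
        have hm0 : (m : ℂ) ≠ 0 := by exact_mod_cast (show m ≠ 0 by omega)
        simp only [Pi.smul_apply, Pi.add_apply, smul_eq_mul, hζ, Complex.ofReal_natCast]
        field_simp
        ring
      have hn := hnear m hmt ζ hζnorm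
      rw [hxζ] at hn
      have hre : (((m : ℝ) : ℂ) ^ g.totalDegree *
          eval (fun i => 2 * Real.pi * I * (q i : ℂ)) (homogeneousComponent g.totalDegree g)).re -
          ‖eval (xs m) g - ((m : ℝ) : ℂ) ^ g.totalDegree *
            eval (fun i => 2 * Real.pi * I * (q i : ℂ)) (homogeneousComponent g.totalDegree g)‖ ≤
          (eval (xs m) g).re := by
        have h := Complex.abs_re_le_norm (eval (xs m) g - ((m : ℝ) : ℂ) ^ g.totalDegree *
          eval (fun i => 2 * Real.pi * I * (q i : ℂ)) (homogeneousComponent g.totalDegree g))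
        rw [Complex.sub_re, abs_le] at h
        linarith [h.1]
      have hre2 : (((m : ℝ) : ℂ) ^ g.totalDegree * eval (fun i => 2 * Real.pi * I * (q i : ℂ))
          (homogeneousComponent g.totalDegree g)).re = c₀ * (m : ℝ) ^ g.totalDegree := by
        rw [← Complex.ofReal_pow, Complex.re_ofReal_mul, hc₀]; ring
      have hpow : (m : ℝ) ≤ (m : ℝ) ^ g.totalDegree := by
        have := pow_le_pow_right₀ (by exact_mod_cast hm1 : (1 : ℝ) ≤ m) hD
        rwa [pow_one] at this
      nlinarith [hre, hre2, hn, hpow, hc₀pos]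
    refine tendsto_atTop_mono' atTop ?_
      ((tendsto_natCast_div_log_atTop).const_mul_atTop (half_pos hc₀pos))
    filter_upwards [hbound, eventually_gt_atTop 2] with m hm hm2
    have hlog : 0 < Real.log m := Real.log_pos (by exact_mod_cast (show 1 < m by omega))
    rw [mul_div_assoc', le_div_iff₀ hlog, div_mul_cancel₀ _ hlog.ne']
    exact hm

/-- **Certified members with dense exponential points (pure targets).**  `A` dominant, `deg g ≥ 2`,
an explosion ray: all seven hypotheses of `ECCell (s+2) (s+1)`, not linearly split,
`W ∩ Γ_exp ≠ ∅` AND `I(W ∩ Γ_exp) = I(W)`. (new)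
[cite: MantovaMasser2023, §1 p.5 (the open case dim π(V) = 2 in ℂ³×ℂˣ³)] -/
theorem polyFibredGraph_pure_member_dense (g : MvPolynomial (Fin (s + 1)) ℂ)
    (hg : 2 ≤ g.totalDegree) (q₀ : Fin (s + 1) → ℤ)
    (hq₀ : 0 < (eval (fun j => 2 * Real.pi * I * (q₀ j : ℂ))
      (homogeneousComponent g.totalDegree g)).re)
    (hq₀0 : ∀ j, q₀ j ≠ 0) (A : Fin (s + 1) → MvPolynomial (Fin (s + 1)) ℂ)
    (hA : Function.Injective
      (aeval A : MvPolynomial (Fin (s + 1)) ℂ →ₐ[ℂ] MvPolynomial (Fin (s + 1)) ℂ)) :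
    (IsIrreducibleClosed ℂ (polyFibredGraph g A (fun _ => 0)) ∧
      (polyFibredGraph g A (fun _ => 0) ∩ torusLocus ℂ (s + 2)).Nonempty ∧
      IsRotund ℂ (s + 2) (polyFibredGraph g A (fun _ => 0) ∩ torusLocus ℂ (s + 2)) ∧
      IsAddFree ℂ (s + 2) (polyFibredGraph g A (fun _ => 0) ∩ torusLocus ℂ (s + 2)) ∧
      IsMulFree ℂ (s + 2) (polyFibredGraph g A (fun _ => 0) ∩ torusLocus ℂ (s + 2)) ∧
      zariskiDim ℂ (polyFibredGraph g A (fun _ => 0)) = (s + 2 : ℕ) ∧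
      addProjDim ℂ (s + 2) (polyFibredGraph g A (fun _ => 0)) = (s + 1 : ℕ)) ∧
    ¬ IsLinearSplit ℂ (s + 2) (polyFibredGraph g A (fun _ => 0)) ∧
    (polyFibredGraph g A (fun _ => 0) ∩ expGraph ℂ (s + 2)).Nonempty ∧
    UnprojectedDense (polyFibredGraph g A (fun _ => 0)) := by
  have hA0 : ∀ j, A j ≠ 0 := by
    intro j hj
    have h1 : (aeval A : MvPolynomial (Fin (s + 1)) ℂ →ₐ[ℂ] MvPolynomial (Fin (s + 1)) ℂ) (X j) =
        (aeval A : MvPolynomial (Fin (s + 1)) ℂ →ₐ[ℂ] MvPolynomial (Fin (s + 1)) ℂ) 0 := by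
      rw [aeval_X, hj, map_zero]
    exact X_ne_zero j (hA h1)
  have hcell := ecCell_hypotheses_polyFibredGraph g A (fun _ => 0) hA hg
  have hdense := unprojectedDense_polyFibredGraph_pure g (by omega) q₀ hq₀ hq₀0 A hA0
  refine ⟨hcell, not_isLinearSplit_polyFibredGraph g A _ (Nat.succ_pos s) hA, ?_, hdense⟩
  obtain ⟨w, hw, -⟩ := hcell.2.1
  exact inter_expGraph_nonempty_of_vanishingIdeal_eq ⟨w, hw⟩ hdense

/-- **Example in `EC(3,2)`: pairs of fixed points of `exp`.**
`W = {x₂ = -(x₀² + x₁²), y₀ = x₀, y₁ = x₁} ⊆ ℂ³ × ℂ³` (exponential points: `e^z = z`, `e^w = w`,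
`y₂ = e^{-(z²+w²)}`): certified member, not linearly split, and `I(W ∩ Γ_exp) = I(W)` — no
algebraic relation `H(e^{-(z²+w²)}, z, w) = 0` holds for all pairs of fixed points of `exp`.
The base has no negative ray (`Re g_D(2πiq) = 4π²|q|² > 0`), so the puncture theorem is silent;
with `F = 0` the balance theorem does not apply. (new)
[cite: MantovaMasser2023, §1 p.5 (the open case dim π(V) = 2 in ℂ³×ℂˣ³)] -/
theorem expFixedPoints_negSumSquares_member_dense :
    (IsIrreducibleClosed ℂ (polyFibredGraph (-(X 0 ^ 2 + X 1 ^ 2) : MvPolynomial (Fin 2) ℂ)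
        (fun j => X j) (fun _ => 0)) ∧
      (polyFibredGraph (-(X 0 ^ 2 + X 1 ^ 2) : MvPolynomial (Fin 2) ℂ) (fun j => X j) (fun _ => 0) ∩
        torusLocus ℂ 3).Nonempty ∧
      IsRotund ℂ 3 (polyFibredGraph (-(X 0 ^ 2 + X 1 ^ 2) : MvPolynomial (Fin 2) ℂ) (fun j => X j)
        (fun _ => 0) ∩ torusLocus ℂ 3) ∧
      IsAddFree ℂ 3 (polyFibredGraph (-(X 0 ^ 2 + X 1 ^ 2) : MvPolynomial (Fin 2) ℂ) (fun j => X j)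
        (fun _ => 0) ∩ torusLocus ℂ 3) ∧
      IsMulFree ℂ 3 (polyFibredGraph (-(X 0 ^ 2 + X 1 ^ 2) : MvPolynomial (Fin 2) ℂ) (fun j => X j)
        (fun _ => 0) ∩ torusLocus ℂ 3) ∧
      zariskiDim ℂ (polyFibredGraph (-(X 0 ^ 2 + X 1 ^ 2) : MvPolynomial (Fin 2) ℂ) (fun j => X j)
        (fun _ => 0)) = (3 : ℕ) ∧
      addProjDim ℂ 3 (polyFibredGraph (-(X 0 ^ 2 + X 1 ^ 2) : MvPolynomial (Fin 2) ℂ) (fun j => X j)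
        (fun _ => 0)) = (2 : ℕ)) ∧
    ¬ IsLinearSplit ℂ 3 (polyFibredGraph (-(X 0 ^ 2 + X 1 ^ 2) : MvPolynomial (Fin 2) ℂ)
        (fun j => X j) (fun _ => 0)) ∧
    (polyFibredGraph (-(X 0 ^ 2 + X 1 ^ 2) : MvPolynomial (Fin 2) ℂ) (fun j => X j) (fun _ => 0) ∩
        expGraph ℂ 3).Nonempty ∧
    UnprojectedDense (polyFibredGraph (-(X 0 ^ 2 + X 1 ^ 2) : MvPolynomial (Fin 2) ℂ)
        (fun j => X j) (fun _ => 0)) := by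
  set g : MvPolynomial (Fin 2) ℂ := -(X 0 ^ 2 + X 1 ^ 2) with hg
  have hhom : g.IsHomogeneous 2 := ((isHomogeneous_X_pow 0 2).add (isHomogeneous_X_pow 1 2)).neg
  have heval : ∀ x : Fin 2 → ℂ, eval x g = -(x 0 ^ 2 + x 1 ^ 2) := fun x => by
    simp [hg, map_add, map_pow, eval_X]
  have hg0 : g ≠ 0 := by
    intro h
    have := heval ![1, 0]
    rw [h, map_zero] at this
    norm_num at this
  have hdeg : g.totalDegree = 2 := hhom.totalDegree hg0
  have hA : Function.Injective (aeval (fun j : Fin 2 => (X j : MvPolynomial (Fin 2) ℂ)) :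
      MvPolynomial (Fin 2) ℂ →ₐ[ℂ] MvPolynomial (Fin 2) ℂ) := by
    rw [aeval_X_left]; exact fun _ _ h => h
  -- the ray `(1,1)`: `Re g_D(2πi(1,1)) = 8π² > 0`
  have hq : 0 < (eval (fun j => 2 * Real.pi * I * (((fun _ => (1 : ℤ)) : Fin 2 → ℤ) j : ℂ))
      (homogeneousComponent g.totalDegree g)).re := by
    rw [hdeg, homogeneousComponent_eq_self hhom, heval]
    simp only [Int.cast_one, mul_one]
    have h1 : -((2 * (Real.pi : ℂ) * I) ^ 2 + (2 * Real.pi * I) ^ 2) = ((8 * Real.pi ^ 2 : ℝ) : ℂ) := by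
      push_cast
      ring_nf
      rw [Complex.I_sq]
      ring
    rw [h1, Complex.ofReal_re]
    positivity
  exact polyFibredGraph_pure_member_dense _ (by rw [hdeg]) (fun _ => 1) hq (fun _ => one_ne_zero) _ hA

end Pure

end Summit.Schanuel.Schanuel.Theorems

end
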